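import Summits.NavierStokesRegularity.NavierStokesRegularity.Theses.AxisTwistDoor
import Summits.NavierStokesRegularity.NavierStokesRegularity.Theorems.AxisTwistDoorTiltDominationLocDefs
import Summits.NavierStokesRegularity.NavierStokesRegularity.Theorems.AxisTwistDoorTiltDominationLocRigidity
import Summits.NavierStokesRegularity.NavierStokesRegularity.Theorems.AxisTwistDoorTiltDominationLocEnergyClass
import Summits.NavierStokesRegularity.NavierStokesRegularity.Theorems.AxisTwistDoorSignConeDefs
import Summits.NavierStokesRegularity.NavierStokesRegularity.Theorems.AxisTwistDoorSignConeSaturatedElement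
import Summits.NavierStokesRegularity.NavierStokesRegularity.Theorems.AxisTwistDoorSignConeInterior
import Summits.NavierStokesRegularity.NavierStokesRegularity.Theorems.AxisTwistDoorSignConeToolkit
import Summits.NavierStokesRegularity.NavierStokesRegularity.Theorems.AxisTwistDoorSignConeWedgeLines
import Summits.NavierStokesRegularity.NavierStokesRegularity.Theorems.AxisTwistDoorTiltDominationLocFluxNondecay
import Summits.NavierStokesRegularity.NavierStokesRegularity.Theorems.AxisTwistDoorSignConeBisectorFrame
import Summits.NavierStokesRegularity.NavierStokesRegularity.Theorems.AxisTwistDoorSignConeFluxDefs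
import HarnessLib

/-!
# LINE `signcone` on crux `AxisTwistDoor.TiltDominationLoc` (stmt-NavierStokesRegularity-26991) — skeleton v7.1 (LEAD ns-atd-p1 g5):
# vocabulary imported from `Theorems/AxisTwistDoorSignConeDefs.lean` (ns-imp-p1 g5, texts verbatim from the birth file), so that stubs
# landed BY NAME over that namespace match the registered signatures literally.
#
# v6 (RESHAPE of the composition, LEAD): the counterexample is SATURATED FIRST (`stub_saturatedElement`, CLOSED BY NAME —
# ns-imp-p1 g5 p650488) and only then split by its sign cone K ∋ e₃, so every later rung may assume `IsSignSaturated w`: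
#   (B⁻) K ∋ −c e₃, c > 0 ⇒ poloidal ⇒ `stub_noPlanarCollar` (= W4, shared);
#   (B)  K ∋ e off ℝe₃: interior K ≠ ∅ ⇒ REGULAR (PROVED: `…SignConeInterior.not_isBackwardSingularPoint_of_interior_signCone_nonempty`,
#        LEAD p649949/p650355/p650614); K ⊇ a line ℝf ⇒ `⟪ω,f⟫ ≡ 0` ⇒ W4 rotated to f (PROVED modulo W4: ns-imp-p1 p653017
#        `…SignConeWedgeLines.not_isBackwardSingularPoint_of_line_subset_signCone_of_stubNoPlanarCollar`); otherwise K is a POINTED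
#        PLANAR WEDGE (⊆ span{e₃,e} by p653425) ⇒ NEW registered stub `stub_properWedgeRigiditySat : StubProperWedgeRigiditySat`
#        (…SignConeDefs, LEAD append p653885) — the research residue of the dihedral rung, WITH saturation as a hypothesis;
#   (C)  K ⊆ ℝ₊e₃ ⇒ `stub_rayRigidity` (the wall).
# Registered open stubs after v6: `stub_noPlanarCollar` (W4), `stub_properWedgeRigiditySat` (research residue), `stub_rayRigidity` (wall).
#
# v7 (LEAD g5, RESHAPE through the flux): Lei–Ren–Tian's final step needs no cone in the one-signed Type-I class —
# `…Theorems.AxisTwistDoorTiltDominationLocFluxNondecay` (p656233: modulo W4, ω₃ ≥ 0 + apex FLUX DECAY ⇒ regular) and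
# `…Theorems.AxisTwistDoorSignConeBisectorFrame` (p656738: two independent one-signed directions + flux decay in a BISECTOR
# FRAME ⇒ regular, outright).  So the two research rungs are now registered in FLUX form — `stub_rayFluxDecaySat :
# StubRayFluxDecaySat` (saturated ray-cone profile, singular apex ⇒ `sup_{𝒬(ρ)} Γ_w → 0`) and `stub_wedgeFluxDecaySat :
# StubWedgeFluxDecaySat` (residue binders, singular apex ⇒ flux decay of a bisector-frame conjugate), Props of
# `Theorems/AxisTwistDoorSignConeFluxDefs.lean` (LEAD g5, p658261; v7.1 = imported, texts byte-identical to v7's local copies) — and the v6 rungs `stub_rayRigidity` / `stub_properWedgeRigiditySat`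
# are DERIVED below (`stubRayRigidity_of`, `stubProperWedgeRigiditySat_of`).  By CENSUS-26991-g5 §9 the open content of each
# flux stub is ONE estimate: the twisting term `∮_{S(r,z)} ω_r (v₃ − v̄₃) dl` on regular-shell circles (LRT eq. Gamma-34)
# without a pointwise cone.  Registered open stubs after v7: `stub_noPlanarCollar` (W4), `stub_wedgeFluxDecaySat` (residue,
# flux form), `stub_rayFluxDecaySat` (wall, flux form).
# History: v1 birth (ns-idea-6 g7) · v2 Defs import · v2.5 saturated closed · v3 dihedral ⇒ planar wedge · v4 planar wedge ⇒ proper wedge ·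
# v5 rung Props imported · v6 saturated residue + composition reshaped (the birth composition is in the tree history, commits
# 2a88e2efeb5d / dc22ca885205, and in the evidence files Lines_signcone_v1…v5 on the item).

## The author's card (birth file, ns-idea-6 g7) — verbatim

ns-idea-6 g7, technique «assume the opposite — build the counterexample until it breaks».
FILES-ONLY line (no route is opened; no summit is proved by a line).

## The counterexample and how it is pushed

Assume `TiltDominationLoc` fails.  By the tree dictionary (`tiltDominationLoc_iff_oneSignedRigidity`,
`oneSignedRigidity_iff_core`, both PROVED) there is a CORE PROFILE `v` — Type-I rate `HasTypeITimeDecay C v`,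
continuity on the open backward slab, the Oseen–Duhamel identity, divergence-free slices — whose vertical
vorticity is ONE-SIGNED, `ω₃ = ⟪curl v, e₃⟫ ≥ 0` on the slab, and which is backward-singular at the apex.

NEW OBJECT — the SIGN CONE of a profile, `SignCone v = {e ∈ ℝ³ : ⟪curl (v s) y, e⟫ ≥ 0 ∀ s < 0 ∀ y}`: a closed
convex cone of ℝ³ (the dual cone of the set of vorticity directions); `e₃ ∈ SignCone v` is the hypothesis.
The crux is organised by the DIMENSION OF THE SPAN of the sign cone of an extremal counterexample:

* span of dimension 3 (non-empty interior) = a pointwise circular cone about some axis = the Lei–Ren–Tian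
  hypothesis [arXiv:2501.08976 Thm 1.1]; regular by the tree's AveragedConeLiouville (stmt-26889 PROVED) after
  RotationToAxis (stmt-24348 PROVED).  This is the KNOWN rung and is subsumed in `StubDihedralRigidity`.
* span of dimension 2: TWO linearly independent one-signed directions `e₃, e`; the vorticity lies pointwise in a
  DIHEDRAL WEDGE of opening `< π`.  NEW RUNG `StubDihedralRigidity`: such a core profile is not backward-singular.
  It interpolates between the cone theorem (opening `< π/2`-type, known) and POLOIDAL rigidity (opening `→ 0`:
  `e → −e₃` forces `ω₃ ≡ 0`, the shared 19708 branch `StubNoPlanarCollar`), and is strictly weaker than the crux.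
* span of dimension 1 (`SignCone w ⊆ ℝ₊ e₃`): the generic case.  Here the counterexample is first pushed to an
  EXTREMAL one: `StubSaturatedElement` — apex zooms `w ↦ λ w(λ² s, λ y)` act on the compact metrisable space of core
  profiles with constant `≤ C` (`exists_tendsto_of_isTypeIAncientMild_seq`), preserve one-signedness
  (`inner_curl_nonneg_of_profileZoom`) and the apex singularity (`persistent_of_energyLedger` /
  `quantitative_persistence`; their scaled-energy hypotheses hold UNIFORMLY along zooms and zoom-limits of one profile because
  the ledger `A, E ≤ K` is AUTOMATIC for the core class — PROVED `…SparseEnergyScaledEnergy.scaledEnergy` — scale-invariant, and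
  closed under limits by Fatou as in PROVED `singularZoom_zoomLimit` (5)–(7)), and along zoom-in
  limits the sign cone can only GROW (a direction non-negative on SOME apex cylinder of `w` is non-negative
  EVERYWHERE on every zoom-in limit); an element of a minimal closed zoom-invariant set of descendants (Birkhoff /
  Zorn) is therefore SIGN-SATURATED: every direction that is one-signed on some apex cylinder is one-signed on the
  whole slab (`IsSignSaturated`).  For a saturated profile with ray sign cone this says: for EVERY direction
  `e ∉ ℝ₊e₃` and EVERY apex cylinder `Q(ρ)`, `⟪ω, e⟫` takes a negative value in `Q(ρ)` — the tilt `ω_h/ω₃` is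
  unbounded in EVERY horizontal direction, with BOTH orientations, at EVERY scale («omnidirectional twist»; the cone
  theorem only gives unboundedness in some direction at each scale).
* THE WALL `StubRayRigidity` (XL, the line's bet): an omnidirectionally twisting one-signed core profile is not
  backward-singular — the stretching `(ω·∇)v₃` needed to keep a singular `ω₃ ≥ 0` alive selects a horizontal
  direction near the apex at some scale, contradicting saturation.

BREAK: the composition `TiltDominationLoc_of_line : TiltDominationLoc` below (the four `stub_*` used by name; hypothesis form
`oneSignedRigidity_of`) is sorry-free as a term; sorries live only in the four `stub_*`.
-/

noncomputable section

set_option linter.dupNamespace false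

namespace Summit.NavierStokesRegularity.NavierStokesRegularity.Cruxes.TiltDominationLoc.SignCone

open MeasureTheory Set Function Filter Topology
open scoped InnerProductSpace RealInnerProductSpace
open Literature.Analysis Literature.Analysis.FluidPDE
open Summit.NavierStokesRegularity.NavierStokesRegularity.Theses.AxisTwistDoor
open Summit.NavierStokesRegularity.NavierStokesRegularity.Theorems.AxisTwistDoorTiltDominationLocDefs
open Summit.NavierStokesRegularity.NavierStokesRegularity.Theorems.AxisTwistDoorTiltDominationLocRigidity
open Summit.NavierStokesRegularity.NavierStokesRegularity.Theorems.AxisTwistDoorTiltDominationLocEnergyClass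
open Summit.NavierStokesRegularity.NavierStokesRegularity.Theorems.AxisTwistDoorSignConeDefs
open Summit.NavierStokesRegularity.NavierStokesRegularity.Theorems.AxisTwistDoorSignConeFluxDefs
open Summit.NavierStokesRegularity.NavierStokesRegularity.Theorems.AxisTwistDoorAveragedConeLiouvilleDefs (FluxDecay)
open Summit.NavierStokesRegularity.NavierStokesRegularity.Theorems.AxisTwistDoorTiltDominationLocFluxNondecay
  (not_isBackwardSingularPoint_of_fluxDecay_core)
open Summit.NavierStokesRegularity.NavierStokesRegularity.Theorems.AxisTwistDoorSignConeBisectorFrame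
  (not_isBackwardSingularPoint_of_fluxDecay_bisectorFrame)

/-! ## Registered stubs -/

/-- BREAK (shared node `StubNoPlanarCollar ↔ PoloidalRigidity`, the 19708 branch; also a stub of FilamentPinchDoor and of
HalfSpaceWindowDoor). -/
theorem stub_noPlanarCollar : StubNoPlanarCollar := by
  sorry

/-- PUSH: saturate the counterexample — CLOSED BY NAME (ns-imp-p1 g5, p650488). -/
theorem stub_saturatedElement : StubSaturatedElement :=
  Summit.NavierStokesRegularity.NavierStokesRegularity.Theorems.AxisTwistDoorSignConeSaturatedElement.stub_saturatedElement

-- v7.1: `StubRayFluxDecaySat` / `StubWedgeFluxDecaySat` are the Props of `…Theorems.AxisTwistDoorSignConeFluxDefs` (LEAD g5, p658261).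

/-- NEW RUNG (registered stub, v7): the residue in FLUX form — bisector-frame apex flux decay. -/
theorem stub_wedgeFluxDecaySat : StubWedgeFluxDecaySat := by
  sorry

/-- THE WALL in FLUX form (registered stub, v7): a saturated ray-cone profile, singular at the apex, has decaying apex flux. -/
theorem stub_rayFluxDecaySat : StubRayFluxDecaySat := by
  sorry

/-! ### The v6 rungs, DERIVED (LEAD g5: p656233 `…FluxNondecay`, p656738 `…SignConeBisectorFrame`) -/

/-- `StubProperWedgeRigiditySat` ⟸ `StubWedgeFluxDecaySat`: the bisector-frame flux decay makes the apex regular outright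
(`…SignConeBisectorFrame.not_isBackwardSingularPoint_of_fluxDecay_bisectorFrame`). -/
theorem stubProperWedgeRigiditySat_of (h : StubWedgeFluxDecaySat) : StubProperWedgeRigiditySat := by
  intro C w hw he3 hsat e he hline hint hptd hsing
  obtain ⟨L, hdet, hL, hflux⟩ := h C w hw he3 hsat e he hline hint hptd hsing
  exact not_isBackwardSingularPoint_of_fluxDecay_bisectorFrame hw.1 hw.2.1 hw.2.2.1 hw.2.2.2 he3 he hline L hdet hL hflux
    hsing

/-- `StubRayRigidity` ⟸ W4 ∧ `StubRayFluxDecaySat`: apex flux decay + `PoloidalRigidity` make the apex regular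
(`…FluxNondecay.not_isBackwardSingularPoint_of_fluxDecay_core`). -/
theorem stubRayRigidity_of (h₀ : StubNoPlanarCollar) (h : StubRayFluxDecaySat) : StubRayRigidity := by
  intro C w hw he3 hray hsing
  have hflux : FluxDecay w := h C w hw he3 hray hsing
  exact not_isBackwardSingularPoint_of_fluxDecay_core (stubNoPlanarCollar_iff_poloidalRigidity.mp h₀) hw.1 hw.2.1 hw.2.2.1
    hw.2.2.2 he3 hflux hsing

/-- The v6 residue rung, now DERIVED from the registered flux stub. -/
theorem properWedgeRigiditySat_of_line : StubProperWedgeRigiditySat :=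
  stubProperWedgeRigiditySat_of stub_wedgeFluxDecaySat

/-- The v6 wall rung, now DERIVED from W4 and the registered flux stub. -/
theorem rayRigidity_of_line : StubRayRigidity :=
  stubRayRigidity_of stub_noPlanarCollar stub_rayFluxDecaySat

/-! ## Composition (sorry-free): the stubs conclude the crux BY NAME. -/

/-- v6 COMPOSITION (core form): saturate first, then split by the sign cone `K ∋ e₃` of the saturated profile `w`:
(B⁻) `K ∋ c e₃` with `c < 0` ⇒ `ω₃ ≡ 0` ⇒ W4 (`StubNoPlanarCollar`); (B) `K ∋ e` off `ℝe₃`: non-empty interior ⇒ regular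
(PROVED, `…SignConeInterior`); `K ⊇ ℝf` ⇒ W4 rotated to `f` (PROVED modulo W4, `…SignConeWedgeLines`); else `K` pointed
planar wedge ⇒ `StubProperWedgeRigiditySat` (with the saturation of `w`); (C) `K ⊆ ℝ₊e₃` ⇒ `StubRayRigidity`. -/
theorem oneSignedRigidity_of (h₀ : StubNoPlanarCollar) (h₂ : StubSaturatedElement)
    (h₃ : StubProperWedgeRigiditySat) (h₄ : StubRayRigidity) : OneSignedRigidity := by
  rw [oneSignedRigidity_iff_core]
  intro C v hrate hcont hmild hdiv hnn hsing
  obtain ⟨C', w, hw, hnn', hsing', hsat⟩ := h₂ ⟨C, v, ⟨hrate, hcont, hmild, hdiv⟩, hnn, hsing⟩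
  by_cases hB : ∃ e ∈ SignCone w, ∀ c : ℝ, 0 ≤ c → e ≠ c • EuclideanSpace.single (2 : Fin 3) (1 : ℝ)
  · obtain ⟨e, he, hne⟩ := hB
    by_cases hline : ∃ c : ℝ, e = c • EuclideanSpace.single (2 : Fin 3) (1 : ℝ)
    · -- (B⁻): `e = c • e₃` with `c < 0`, so `ω₃ ≤ 0` as well: the profile is poloidal.
      obtain ⟨c, rfl⟩ := hline
      have hc : c < 0 := by
        by_contra hc
        exact hne c (not_lt.mp hc) rfl
      have hpol : ∀ s < 0, ∀ y : EuclideanSpace ℝ (Fin 3),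
          ⟪curl (w s) y, EuclideanSpace.single (2 : Fin 3) (1 : ℝ)⟫_ℝ = 0 := by
        intro s hs y
        have h1 : 0 ≤ ⟪curl (w s) y, EuclideanSpace.single (2 : Fin 3) (1 : ℝ)⟫_ℝ := hnn' s hs y
        have h2 : 0 ≤ ⟪curl (w s) y, c • EuclideanSpace.single (2 : Fin 3) (1 : ℝ)⟫_ℝ := he s hs y
        rw [real_inner_smul_right] at h2
        nlinarith
      have hPR : PoloidalRigidity := stubNoPlanarCollar_iff_poloidalRigidity.mp h₀
      rw [poloidalRigidity_iff_typeI] at hPR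
      exact hPR C' w hw.1 hw.2.1 hw.2.2.1 hw.2.2.2 hpol hsing'
    · -- (B): a second one-signed direction off the line `ℝ e₃`.
      push Not at hline
      by_cases hint : (interior (SignCone w)).Nonempty
      · -- dimension 3: pointwise Lei–Ren–Tian cone ⇒ regular (PROVED)
        exact Summit.NavierStokesRegularity.NavierStokesRegularity.Theorems.AxisTwistDoorSignConeInterior.not_isBackwardSingularPoint_of_interior_signCone_nonempty
          hw.1 hw.2.1 hw.2.2.1 hw.2.2.2 hint hsing'
      · by_cases hptd : ∀ f : EuclideanSpace ℝ (Fin 3), f ∈ SignCone w → -f ∈ SignCone w → f = 0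
        · -- pointed planar wedge: the research residue, with saturation
          exact h₃ C' w hw hnn' hsat e he hline (Set.not_nonempty_iff_eq_empty.1 hint) hptd hsing'
        · -- the cone contains a line `ℝf`: `⟪ω, f⟫ ≡ 0`, W4 rotated to `f` (PROVED modulo W4)
          push Not at hptd
          obtain ⟨f, hf, hnf, hf0⟩ := hptd
          exact Summit.NavierStokesRegularity.NavierStokesRegularity.Theorems.AxisTwistDoorSignConeWedgeLines.not_isBackwardSingularPoint_of_line_subset_signCone_of_stubNoPlanarCollar
            h₀ hw hf0 hf hnf hsing'
  · -- (C): the sign cone is the ray `ℝ₊ e₃`; with saturation, ray rigidity applies.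
    push Not at hB
    refine h₄ C' w hw hnn' ?_ hsing'
    intro e hloc
    obtain ⟨c, hc, hce⟩ := hB e (hsat e hloc)
    exact ⟨c, hc, hce⟩

/-- THE SKELETON (registered shape: concludes `AxisTwistDoor.TiltDominationLoc` BY NAME, no hypotheses; the registered `stub_*`
(v7: `stub_noPlanarCollar`, `stub_wedgeFluxDecaySat`, `stub_rayFluxDecaySat`) enter through the derived v6 rungs;
hypothesis form = `oneSignedRigidity_of` + the PROVED dictionary `tiltDominationLoc_iff_oneSignedRigidity`). -/
theorem TiltDominationLoc_of_line : TiltDominationLoc :=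
  tiltDominationLoc_iff_oneSignedRigidity.mpr
    (oneSignedRigidity_of stub_noPlanarCollar stub_saturatedElement properWedgeRigiditySat_of_line rayRigidity_of_line)

end Summit.NavierStokesRegularity.NavierStokesRegularity.Cruxes.TiltDominationLoc.SignCone

end
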